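/-
Copyright (c) 2026 the pub-hodgecm-mathlib formalisation cell (harness21).  Prover seat hodgecm-mathlib-LH4-p10 (g3): dealer LH4-plan (g12) WORD #21 «SOCKET READER for (ρ2b′-X)» —
the reader's tie leg (S2′-E) «UNRAMIFIED QUADRATIC COMPLETION DICTIONARY» between the pay line's type-U token and the INPUT letters of ★ S2′ `exists_thirdFieldPackage_unr` ∕ ★ T5a.  2026-09-04.
-/
import Literature.NumberTheory.Automorphic.UnitaryGroupIntegralPointsReductionInert   -- ★ `natCard_residueField_eq_sq_of_inert`, `natCard_residueField_valuativeRel_eq` (+ ★ Liu2021 InertFrobenius `exists_smul_sub_not_mem`)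
import Literature.NumberTheory.Automorphic.ValuedFieldValuativeRelBridge               -- ★ `natCard_residueField_eq_of_compatible`
import Literature.NumberTheory.Automorphic.QuadraticLocalBaseChange                    -- ★ `toPlace`, `valued_toPlace`
import Literature.NumberTheory.Automorphic.UnitaryGroupIntegralPointsReductionRamified -- ED. 2: ★ `natCard_residueField_eq_of_ramified` (+ ★ Liu2021 RamifiedConverse `valued_galAdicCompletionMap_sub_lt_one_of_ramified`, RamifiedPlace `ramificationIdx'_eq_two_of_ne_one`)
import Literature.NumberTheory.Automorphic.Liu2021.LemD1AsPrintedIndexedNonVacuityInertCofinite -- ED. 2: ★ `ramificationIdx'_eq_one_of_isUnramifiedIn`, `valued_toPlace_of_isUnramifiedIn` (quoted, not restated)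
import HarnessLib

/-!
# F0 · P3c · line LH4 «(D-RAM) FOUR-FRAME» — (ρ2b′-X) road, seam (S2′-E): the UNRAMIFIED QUADRATIC COMPLETION DICTIONARY (socket-reader adapter)

Cell `pub/hodgecm-mathlib`, crux H413 = `stmt-HodgeConjecture-24833` (helper lane `--supports stmt-HodgeConjecture-24833 --as helper`), route HCCMUnconditional; THEOREMS ONLY
(pure assembly of ★ Literature lemmas; no definition, no instance, no notation, no `sorry`).

SETTING (the letters of the payer's socket `SOCKET-hLM.v1` with `(F, E, c, v, w) := (L, E′, c₁, w.1, w₁)`): `E/F` a quadratic extension of number fields with non-trivial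
`c ∈ Aut(E/F)`, a finite place `v` of `F` and `w ∣ v` with `c • w = w` (non-split), `ι_w = toPlace v w : F_v →+* E_w`, `σ_w = galAdicCompletionMap c hw : E_w →+* E_w`.
TYPE U = «`v` unramified in `E`» (`Algebra.IsUnramifiedIn (𝓞 E) v`, equivalently `e(w|v) = 1`).  The dictionary the type-U weld of :418 consumes (LH4-p10 (g3) LINE #15):
* §0 `ramificationIdx'_ne_one_of_not_isUnramifiedIn` — the COMPLEMENTARY type token (`¬ IsUnramifiedIn` ⟹ the `he : e(w|v) ≠ 1` letter of the ★ ramified-place lemmas); the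
  positive direction and (E1) `v_w(ι_w a) = v_v(a)` (feeds `hϖE`, `hddE`, `hfixE`, `h2t`) are ALREADY ★: `Liu2021.LemD1IndexedNonVacuityInertCofinite.ramificationIdx'_eq_one_of_isUnramifiedIn`,
  `….valued_toPlace_of_isUnramifiedIn`, `….inertiaDeg_eq_two_of_smul_eq_of_isUnramifiedIn` (module `Literature.NumberTheory.Automorphic.Liu2021.LemD1AsPrintedIndexedNonVacuityInertCofinite`) —
  import and quote them by name (not restated here);
* §1 (E2) `natCard_residueField_eq_sq_of_isUnramifiedIn : |𝓀(E_w)| = |𝓀(F_v)|²` in the `Valued.ResidueField` currency of :418's q-token (+ the `Fintype.card` form) — feeds `hq`;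
* §2 (E3) `exists_v_sub_galAdicCompletionMap_eq_one : ∃ z, |z| ≤ 1 ∧ |z − σ_w z| = 1` (σ̄_w = Frob_{q_v} ≠ id on `𝓀(E_w) = 𝔽_{q_v²}`);
* §3 (E4) `v_sub_map_eq_one_of_forall_div_le` (any valued field: an integral `α` with the integrality quotient property `|(z − ρz)∕(α − ρα)| ≤ 1` has `|α − ρα| = 1` as soon as
  (E3) holds) and the weld `v_sub_galAdicCompletionMap_eq_one_of_isUnramifiedIn` — feeds S2′'s `hα : Valued.v (α − ρ α) = 1` from the eigen-package's FILE C letters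
  (`ρ α ≠ α`, `|α| ≤ 1`, `hint`).
HONEST LABEL: HC_CM is proved only modulo the 7 printed citations (2 remaining: hLiu418 = stmt-HodgeConjecture-24832, h413 = stmt-HodgeConjecture-24833) until rung 0 closes;
count-neutral adapter; (ρ2b′-X) stays OPEN modulo the organ package.

ED. 2 (§4, payer LH4-p14 (g4) 06:33Z «(S2′-E) frame dictionary → p10»): the α-KEYED dictionary for the typed sockets `SOCKET-hOCA∕B∕C.v1` — the converse
`|α − σ_w α| = 1 ⟹ IsUnramifiedIn` (and `↔`), and under `|α − σ_w α| = 1` resp. `< 1`: `e = 1` ∕ `e ≠ 1, e = 2`, `v_w(ι_w a) = v_v(a)` ∕ `= v_v(a)²`,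
`|𝓀(E_w)| = |𝓀(F_v)|²` ∕ `= |𝓀(F_v)|` (Nat.card and Fintype.card forms).

## References
* [NeukirchANT1999] J. Neukirch, *Algebraic Number Theory*, Grundlehren 322 (1999): Ch. I §8 Prop. (8.2), §9 Prop. (9.6); Ch. II §4 Prop. (4.3).
* [Serre1979] J.-P. Serre, *Local Fields*, GTM 67 (1979): Ch. I §7–§8, Ch. III §5.
-/

set_option autoImplicit false

namespace Summit.HodgeConjecture.HodgeConjecture.Cruxes.H413.F0P3cDyRamUnramifiedQuadraticCompletionDictionary

open NumberField IsDedekindDomain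
open Literature.NumberTheory.Automorphic Literature.NumberTheory.Automorphic.UnitaryGroup
open scoped ValuativeRel WithZero

section Global

variable {F : Type} (E : Type) [Field F] [NumberField F] [Field E] [NumberField E] [Algebra F E]
  [Algebra.IsQuadraticExtension F E] (c : E ≃ₐ[F] E) (v : HeightOneSpectrum (𝓞 F))

/-! ## §0 The complementary type token: `¬ IsUnramifiedIn` gives the `e(w|v) ≠ 1` letter of the ★ ramified-place lemmas -/

/-- **the complementary token**: at a NON-SPLIT place (`c ≠ 1`, `c • w = w`, so `w` is the only prime above `v`, ★ `PlacesOver.eq_of_smul_eq`), `v` NOT unramified in `E`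
⟹ `e(w|v) ≠ 1` (Mathlib `Ideal.ramificationIdx_eq_one_iff`) — the `he` letter of the ★ ramified-place lemmas (`natCard_residueField_eq_of_ramified`, …).
[cite: NeukirchANT1999, Ch. I §8 Prop. (8.2)] -/
theorem ramificationIdx'_ne_one_of_not_isUnramifiedIn (hc : c ≠ 1) (w : PlacesOver E v) (hw : c • w.1 = w.1)
    (hv : ¬ Algebra.IsUnramifiedIn (𝓞 E) v.asIdeal) : v.asIdeal.ramificationIdx' w.1.asIdeal ≠ 1 := by
  haveI : w.1.asIdeal.LiesOver v.asIdeal := PlacesOver.liesOver w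
  haveI : v.asIdeal.IsMaximal := v.isMaximal
  haveI : w.1.asIdeal.IsMaximal := w.1.isMaximal
  intro h1
  apply hv
  intro P hP hPl
  have hP0 : P ≠ ⊥ := Ideal.ne_bot_of_liesOver_of_ne_bot v.ne_bot P
  have hPw : P = w.1.asIdeal := congrArg (fun u : PlacesOver E v => u.1.asIdeal)
    (PlacesOver.eq_of_smul_eq c hc w hw ⟨⟨P, hP, hP0⟩, HeightOneSpectrum.ext hPl.over.symm⟩)
  subst hPw
  rw [Ideal.ramificationIdx'_eq_ramificationIdx v.asIdeal w.1.asIdeal v.ne_bot] at h1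
  exact Ideal.ramificationIdx_eq_one_iff.mp h1

/-! ## §1 (E2) the residue field of `E_w` has `q_v²` elements -/

/-- **(E2) `|𝓀(E_w)| = |𝓀(F_v)|²` at a non-split unramified place**, in the `Valued.ResidueField` currency of :418's q-token (★ `natCard_residueField_eq_sq_of_inert`:
`|𝓀[E_w]| = |𝓞_F ∕ v|²` in the `ValuativeRel` currency; ★ `natCard_residueField_eq_of_compatible` twice; ★ `natCard_residueField_valuativeRel_eq` for `F_v`).
[cite: NeukirchANT1999, Ch. II §4 Prop. (4.3)] -/
theorem natCard_residueField_eq_sq_of_isUnramifiedIn (hc : c ≠ 1) (hv : Algebra.IsUnramifiedIn (𝓞 E) v.asIdeal) (w : PlacesOver E v)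
    (hw : c • w.1 = w.1) :
    Nat.card (Valued.ResidueField (w.1.adicCompletion E)) = Nat.card (Valued.ResidueField (v.adicCompletion F)) ^ 2 := by
  rw [← natCard_residueField_eq_of_compatible (K := w.1.adicCompletion E), natCard_residueField_eq_sq_of_inert c v hc hv w hw,
    ← natCard_residueField_eq_of_compatible (K := v.adicCompletion F), natCard_residueField_valuativeRel_eq v]

/-- The `Fintype.card` form of (E2), token-aligned with :418's `Fintype.card (Valued.ResidueField (w.1.adicCompletion L))` (any `Fintype` instances).
[cite: NeukirchANT1999, Ch. II §4 Prop. (4.3)] -/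
theorem fintypeCard_residueField_eq_sq_of_isUnramifiedIn (hc : c ≠ 1) (hv : Algebra.IsUnramifiedIn (𝓞 E) v.asIdeal) (w : PlacesOver E v)
    (hw : c • w.1 = w.1) [Fintype (Valued.ResidueField (w.1.adicCompletion E))] [Fintype (Valued.ResidueField (v.adicCompletion F))] :
    Fintype.card (Valued.ResidueField (w.1.adicCompletion E)) = Fintype.card (Valued.ResidueField (v.adicCompletion F)) ^ 2 := by
  rw [Fintype.card_eq_nat_card, Fintype.card_eq_nat_card]
  exact natCard_residueField_eq_sq_of_isUnramifiedIn E c v hc hv w hw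

/-- (E2) against the GLOBAL q-token `|𝓞_F ∕ v|` (the right-hand letter of ★ S0 `natCard_quot_eq_card_residueField`). [cite: NeukirchANT1999, Ch. II §4 Prop. (4.3)] -/
theorem natCard_residueField_eq_natCard_quot_sq_of_isUnramifiedIn (hc : c ≠ 1) (hv : Algebra.IsUnramifiedIn (𝓞 E) v.asIdeal) (w : PlacesOver E v)
    (hw : c • w.1 = w.1) :
    Nat.card (Valued.ResidueField (w.1.adicCompletion E)) = Nat.card (𝓞 F ⧸ v.asIdeal) ^ 2 := by
  rw [← natCard_residueField_eq_of_compatible (K := w.1.adicCompletion E), natCard_residueField_eq_sq_of_inert c v hc hv w hw]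

/-! ## §2 (E3) an integral element moved by `σ_w` to residual distance `1` -/

/-- **(E3) at a non-split UNRAMIFIED place some `z ∈ 𝒪_w` has `v_w(z − σ_w z) = 1`**: the residue automorphism `σ̄_w` is the `q_v`-Frobenius of `𝓀(E_w) = 𝔽_{q_v²}`, not the
identity — take the image of a global `u ∈ 𝓞_E` with `c • u − u ∉ 𝔭_w` (★ Liu2021 `…InertFrobenius.exists_smul_sub_not_mem`). [cite: NeukirchANT1999, Ch. I §9 Prop. (9.6)] -/
theorem exists_v_sub_galAdicCompletionMap_eq_one (hc : c ≠ 1) (hv : Algebra.IsUnramifiedIn (𝓞 E) v.asIdeal) (w : PlacesOver E v)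
    (hw : c • w.1 = w.1) :
    ∃ z : w.1.adicCompletion E, Valued.v z ≤ 1 ∧ Valued.v (z - galAdicCompletionMap (L := E) c hw z) = 1 := by
  obtain ⟨u, hu⟩ := Liu2021.LemD1IndexedNonVacuityInertFrobenius.exists_smul_sub_not_mem E c v hc hv w hw
  refine ⟨(((u : 𝓞 E) : E) : w.1.adicCompletion E), ?_, ?_⟩
  · rw [HeightOneSpectrum.valuedAdicCompletion_eq_valuation', RingOfIntegers.coe_eq_algebraMap]
    exact HeightOneSpectrum.valuation_le_one w.1 u
  · have hca : galAdicCompletionMap (L := E) c hw ((((u : 𝓞 E) : E) : w.1.adicCompletion E)) = (((c • u : 𝓞 E) : E) : w.1.adicCompletion E) := by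
      rw [galAdicCompletionMap_coe_algEquiv]
      rfl
    rw [Valuation.map_sub_swap, hca]
    have h1' : ((c • u - u : 𝓞 E) : E) = ((c • u : 𝓞 E) : E) - ((u : 𝓞 E) : E) := by push_cast; rfl
    have h1 : (((c • u : 𝓞 E) : E) : w.1.adicCompletion E) - (((u : 𝓞 E) : E) : w.1.adicCompletion E) =
        (((c • u - u : 𝓞 E) : E) : w.1.adicCompletion E) := by
      change algebraMap E (w.1.adicCompletion E) ((c • u : 𝓞 E) : E) - algebraMap E (w.1.adicCompletion E) ((u : 𝓞 E) : E) =
        algebraMap E (w.1.adicCompletion E) ((c • u - u : 𝓞 E) : E)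
      rw [h1', map_sub]
    rw [h1, HeightOneSpectrum.valuedAdicCompletion_eq_valuation', RingOfIntegers.coe_eq_algebraMap]
    refine le_antisymm (HeightOneSpectrum.valuation_le_one w.1 _) (not_lt.1 fun hlt => hu ?_)
    exact (HeightOneSpectrum.valuation_lt_one_iff_mem _ _).1 hlt

end Global

/-! ## §3 (E4) the integral generator of an unramified quadratic extension is moved to distance `1` -/

section Local

variable {K : Type} [Field K] [Valued K ℤᵐ⁰]

/-- **(E4) `|α − ρα| = 1` from the integrality quotient property**: in any valued field, if `ρ` preserves `|·|`, `|α| ≤ 1`, `ρ α ≠ α`, every integral `z` has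
`|(z − ρz)∕(α − ρα)| ≤ 1` (the eigen-package's FILE C letter `hint`: `{1, α}` is an integral basis relative to `ρ`), and SOME integral `z` has `|z − ρz| = 1` (E3), then
`|α − ρα| = 1`.  (`1 = |z − ρz| = |(z − ρz)∕(α − ρα)|·|α − ρα| ≤ |α − ρα| ≤ max(|α|, |ρα|) ≤ 1`.) [cite: Serre1979, Ch. III §5] -/
theorem v_sub_map_eq_one_of_forall_div_le {ρ : K →+* K} (hvρ : ∀ x, Valued.v (ρ x) = Valued.v x) {α : K} (hρα : ρ α ≠ α)
    (hα1 : Valued.v α ≤ 1) (hint : ∀ z : K, Valued.v z ≤ 1 → Valued.v ((z - ρ z) / (α - ρ α)) ≤ 1)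
    (hz : ∃ z : K, Valued.v z ≤ 1 ∧ Valued.v (z - ρ z) = 1) : Valued.v (α - ρ α) = 1 := by
  obtain ⟨z, hz1, hzρ⟩ := hz
  have hα0 : α - ρ α ≠ 0 := sub_ne_zero.2 (Ne.symm hρα)
  refine le_antisymm ?_ ?_
  · calc Valued.v (α - ρ α) ≤ max (Valued.v α) (Valued.v (ρ α)) := Valuation.map_sub _ _ _
      _ ≤ 1 := max_le hα1 (by rw [hvρ]; exact hα1)
  · have h := hint z hz1
    have heq : z - ρ z = (z - ρ z) / (α - ρ α) * (α - ρ α) := (div_mul_cancel₀ _ hα0).symm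
    rw [heq, Valuation.map_mul, mul_comm] at hzρ
    -- `|α − ρα| · |q| = 1` with `|q| ≤ 1` forces `1 ≤ |α − ρα|`
    calc (1 : ℤᵐ⁰) = Valued.v (α - ρ α) * Valued.v ((z - ρ z) / (α - ρ α)) := hzρ.symm
      _ ≤ Valued.v (α - ρ α) * 1 := by gcongr
      _ = Valued.v (α - ρ α) := mul_one _

end Local

section Weld

variable {F : Type} (E : Type) [Field F] [NumberField F] [Field E] [NumberField E] [Algebra F E]
  [Algebra.IsQuadraticExtension F E] (c : E ≃ₐ[F] E) (v : HeightOneSpectrum (𝓞 F))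

/-- **THE WELD for S2′'s `hα`**: at a non-split UNRAMIFIED place, an integral `α ∈ E_w` with `σ_w α ≠ α` and the integrality quotient property (the eigen-package ★ p857432 FILE C
letters `hα, hα1, hint` verbatim, `ρ := σ_w`) satisfies `|α − σ_w α| = 1` — the INPUT letter `hα : Valued.v (α - ρ α) = 1` of ★ S2′ `exists_thirdFieldPackage_unr` ∕ ★ T5a
`ncard_levelSet_unr_hyper`. [cite: Serre1979, Ch. III §5] [cite: NeukirchANT1999, Ch. I §9 Prop. (9.6)] -/
theorem v_sub_galAdicCompletionMap_eq_one_of_isUnramifiedIn (hc : c ≠ 1) (hv : Algebra.IsUnramifiedIn (𝓞 E) v.asIdeal) (w : PlacesOver E v)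
    (hw : c • w.1 = w.1) {α : w.1.adicCompletion E} (hα : galAdicCompletionMap (L := E) c hw α ≠ α) (hα1 : Valued.v α ≤ 1)
    (hint : ∀ z : w.1.adicCompletion E, Valued.v z ≤ 1 →
      Valued.v ((z - galAdicCompletionMap (L := E) c hw z) / (α - galAdicCompletionMap (L := E) c hw α)) ≤ 1) :
    Valued.v (α - galAdicCompletionMap (L := E) c hw α) = 1 :=
  v_sub_map_eq_one_of_forall_div_le (fun x => valued_galAdicCompletionMap E c hw x) hα hα1 hint
    (exists_v_sub_galAdicCompletionMap_eq_one E c v hc hv w hw)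

end Weld

/-! ## §4 (ED. 2) THE α-KEYED DICTIONARY — the converse `|α − σ_w α| = 1 ⟹ e(w|v) = 1` and both branches in the letters of the payer's typed sockets

The payer's TYPE SPLIT (LH4-p14 (g4) `…TypeSplit.orderCountCensus2_of_types`, sockets `SOCKET-hOCA∕B∕C.v1`) hands the descent type down as `Valued.v (α - ρ α) = 1 →` (types A, B:
`M ∕ L_w` unramified) or `Valued.v (α - ρ α) < 1 →` (type C: ramified), `ρ = galAdicCompletionMap c₁ hw₁`, with the eigen-package's FILE C letters `hα : ρ α ≠ α`, `hα1 : |α| ≤ 1`,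
`hint` in scope.  This section turns that one letter into every frame token the three bottom theorems need. -/

section AlphaKeyed

variable {F : Type} (E : Type) [Field F] [NumberField F] [Field E] [NumberField E] [Algebra F E]
  [Algebra.IsQuadraticExtension F E] (c : E ≃ₐ[F] E) (v : HeightOneSpectrum (𝓞 F))

/-- **at a RAMIFIED non-split place every integral element is moved to distance `< 1`** — the type-C letter from the type token: `¬ IsUnramifiedIn ⟹ |α − σ_w α| < 1`
for `|α| ≤ 1` (★ Liu2021 `…RamifiedConverse.valued_galAdicCompletionMap_sub_lt_one_of_ramified`, `he` from §0). [cite: NeukirchANT1999, Ch. I §9 Prop. (9.6); Ch. II §4 Prop. (4.3)] -/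
theorem v_sub_galAdicCompletionMap_lt_one_of_not_isUnramifiedIn (hc : c ≠ 1) (w : PlacesOver E v) (hw : c • w.1 = w.1)
    (hv : ¬ Algebra.IsUnramifiedIn (𝓞 E) v.asIdeal) {α : w.1.adicCompletion E} (hα1 : Valued.v α ≤ 1) :
    Valued.v (α - galAdicCompletionMap (L := E) c hw α) < 1 := by
  rw [Valuation.map_sub_swap]
  exact Liu2021.LemD1IndexedNonVacuityRamifiedConverse.valued_galAdicCompletionMap_sub_lt_one_of_ramified E c v hc w hw
    (ramificationIdx'_ne_one_of_not_isUnramifiedIn E c v hc w hw hv) α hα1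

/-- **THE CONVERSE: `|α − σ_w α| = 1` for some integral `α` ⟹ `v` is unramified in `E`** (types A∕B ⟹ the `IsUnramifiedIn` token of §§1–3 and of ★ InertCofinite).
[cite: NeukirchANT1999, Ch. I §9 Prop. (9.6); Ch. II §4 Prop. (4.3)] -/
theorem isUnramifiedIn_of_v_sub_galAdicCompletionMap_eq_one (hc : c ≠ 1) (w : PlacesOver E v) (hw : c • w.1 = w.1)
    {α : w.1.adicCompletion E} (hα1 : Valued.v α ≤ 1) (hα : Valued.v (α - galAdicCompletionMap (L := E) c hw α) = 1) :
    Algebra.IsUnramifiedIn (𝓞 E) v.asIdeal := by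
  by_contra hv
  exact absurd hα (ne_of_lt (v_sub_galAdicCompletionMap_lt_one_of_not_isUnramifiedIn E c v hc w hw hv hα1))

/-- **`|α − σ_w α| = 1 ⟺ v unramified in E`** for the eigen-package's integral generator `α` (`σ_w α ≠ α`, `|α| ≤ 1`, `hint`). [cite: NeukirchANT1999, Ch. II §4 Prop. (4.3)] -/
theorem v_sub_galAdicCompletionMap_eq_one_iff_isUnramifiedIn (hc : c ≠ 1) (w : PlacesOver E v) (hw : c • w.1 = w.1)
    {α : w.1.adicCompletion E} (hα : galAdicCompletionMap (L := E) c hw α ≠ α) (hα1 : Valued.v α ≤ 1)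
    (hint : ∀ z : w.1.adicCompletion E, Valued.v z ≤ 1 →
      Valued.v ((z - galAdicCompletionMap (L := E) c hw z) / (α - galAdicCompletionMap (L := E) c hw α)) ≤ 1) :
    Valued.v (α - galAdicCompletionMap (L := E) c hw α) = 1 ↔ Algebra.IsUnramifiedIn (𝓞 E) v.asIdeal :=
  ⟨isUnramifiedIn_of_v_sub_galAdicCompletionMap_eq_one E c v hc w hw hα1,
    fun hv => v_sub_galAdicCompletionMap_eq_one_of_isUnramifiedIn E c v hc hv w hw hα hα1 hint⟩

/-! ### Types A∕B (`|α − σ_w α| = 1`): `e = 1`, `ι_w` isometric, `|𝓀(E_w)| = |𝓀(F_v)|²` -/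

/-- **types A∕B: `e(w|v) = 1`** (the index of ★ `valued_toPlace`; ★ InertCofinite `ramificationIdx'_eq_one_of_isUnramifiedIn`). [cite: NeukirchANT1999, Ch. I §8 Prop. (8.2)] -/
theorem ramificationIdx'_eq_one_of_v_sub_galAdicCompletionMap_eq_one (hc : c ≠ 1) (w : PlacesOver E v) (hw : c • w.1 = w.1)
    {α : w.1.adicCompletion E} (hα1 : Valued.v α ≤ 1) (hα : Valued.v (α - galAdicCompletionMap (L := E) c hw α) = 1) :
    v.asIdeal.ramificationIdx' w.1.asIdeal = 1 :=
  Liu2021.LemD1IndexedNonVacuityInertCofinite.ramificationIdx'_eq_one_of_isUnramifiedIn E v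
    (isUnramifiedIn_of_v_sub_galAdicCompletionMap_eq_one E c v hc w hw hα1 hα) w

/-- **types A∕B: `v_w(ι_w a) = v_v(a)`** (★ InertCofinite `valued_toPlace_of_isUnramifiedIn`) — feeds `hϖE : |ι ϖ| = exp(−1)`, `hddE`, `hfixE`, `h2t`. [cite: NeukirchANT1999, Ch. II §4 Prop. (4.3)] -/
theorem valued_toPlace_of_v_sub_galAdicCompletionMap_eq_one (hc : c ≠ 1) (w : PlacesOver E v) (hw : c • w.1 = w.1)
    {α : w.1.adicCompletion E} (hα1 : Valued.v α ≤ 1) (hα : Valued.v (α - galAdicCompletionMap (L := E) c hw α) = 1)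
    (a : v.adicCompletion F) : Valued.v (toPlace v w a) = Valued.v a :=
  Liu2021.LemD1IndexedNonVacuityInertCofinite.valued_toPlace_of_isUnramifiedIn E v
    (isUnramifiedIn_of_v_sub_galAdicCompletionMap_eq_one E c v hc w hw hα1 hα) w a

/-- **types A∕B: `|𝓀(E_w)| = |𝓀(F_v)|²`** in the `Valued.ResidueField` currency (§1) — the `hq : Nat.card 𝓀[M] = q ^ 2` letter of ★ S2′ ∕ ★ T5a. [cite: NeukirchANT1999, Ch. II §4 Prop. (4.3)] -/
theorem natCard_residueField_eq_sq_of_v_sub_galAdicCompletionMap_eq_one (hc : c ≠ 1) (w : PlacesOver E v) (hw : c • w.1 = w.1)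
    {α : w.1.adicCompletion E} (hα1 : Valued.v α ≤ 1) (hα : Valued.v (α - galAdicCompletionMap (L := E) c hw α) = 1) :
    Nat.card (Valued.ResidueField (w.1.adicCompletion E)) = Nat.card (Valued.ResidueField (v.adicCompletion F)) ^ 2 :=
  natCard_residueField_eq_sq_of_isUnramifiedIn E c v hc (isUnramifiedIn_of_v_sub_galAdicCompletionMap_eq_one E c v hc w hw hα1 hα) w hw

/-- The `Fintype.card` form of the previous statement (token of :418: `Fintype.card (Valued.ResidueField (w.1.adicCompletion L))`). [cite: NeukirchANT1999, Ch. II §4 Prop. (4.3)] -/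
theorem fintypeCard_residueField_eq_sq_of_v_sub_galAdicCompletionMap_eq_one (hc : c ≠ 1) (w : PlacesOver E v) (hw : c • w.1 = w.1)
    {α : w.1.adicCompletion E} (hα1 : Valued.v α ≤ 1) (hα : Valued.v (α - galAdicCompletionMap (L := E) c hw α) = 1)
    [Fintype (Valued.ResidueField (w.1.adicCompletion E))] [Fintype (Valued.ResidueField (v.adicCompletion F))] :
    Fintype.card (Valued.ResidueField (w.1.adicCompletion E)) = Fintype.card (Valued.ResidueField (v.adicCompletion F)) ^ 2 :=
  fintypeCard_residueField_eq_sq_of_isUnramifiedIn E c v hc (isUnramifiedIn_of_v_sub_galAdicCompletionMap_eq_one E c v hc w hw hα1 hα) w hw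

/-! ### Type C (`|α − σ_w α| < 1`): `e ≠ 1`, `e = 2`, `v_w(ι_w a) = v_v(a)²`, `|𝓀(E_w)| = |𝓀(F_v)|` -/

/-- **type C: `e(w|v) ≠ 1`** — the `he` letter of every ★ ramified-place lemma, from the type-C letter and the FILE C letters (`σ_w α ≠ α`, `|α| ≤ 1`, `hint`).
[cite: NeukirchANT1999, Ch. I §8 Prop. (8.2)] -/
theorem ramificationIdx'_ne_one_of_v_sub_galAdicCompletionMap_lt_one (hc : c ≠ 1) (w : PlacesOver E v) (hw : c • w.1 = w.1)
    {α : w.1.adicCompletion E} (hα : galAdicCompletionMap (L := E) c hw α ≠ α) (hα1 : Valued.v α ≤ 1)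
    (hint : ∀ z : w.1.adicCompletion E, Valued.v z ≤ 1 →
      Valued.v ((z - galAdicCompletionMap (L := E) c hw z) / (α - galAdicCompletionMap (L := E) c hw α)) ≤ 1)
    (hlt : Valued.v (α - galAdicCompletionMap (L := E) c hw α) < 1) : v.asIdeal.ramificationIdx' w.1.asIdeal ≠ 1 :=
  ramificationIdx'_ne_one_of_not_isUnramifiedIn E c v hc w hw fun hv =>
    absurd (v_sub_galAdicCompletionMap_eq_one_of_isUnramifiedIn E c v hc hv w hw hα hα1 hint) (ne_of_lt hlt)

/-- **type C: `e(w|v) = 2`** (★ Liu2021 `…RamifiedPlace.ramificationIdx'_eq_two_of_ne_one`). [cite: NeukirchANT1999, Ch. I §8 Prop. (8.2)] -/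
theorem ramificationIdx'_eq_two_of_v_sub_galAdicCompletionMap_lt_one (hc : c ≠ 1) (w : PlacesOver E v) (hw : c • w.1 = w.1)
    {α : w.1.adicCompletion E} (hα : galAdicCompletionMap (L := E) c hw α ≠ α) (hα1 : Valued.v α ≤ 1)
    (hint : ∀ z : w.1.adicCompletion E, Valued.v z ≤ 1 →
      Valued.v ((z - galAdicCompletionMap (L := E) c hw z) / (α - galAdicCompletionMap (L := E) c hw α)) ≤ 1)
    (hlt : Valued.v (α - galAdicCompletionMap (L := E) c hw α) < 1) : v.asIdeal.ramificationIdx' w.1.asIdeal = 2 :=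
  Liu2021.LemD1IndexedNonVacuityRamifiedPlace.ramificationIdx'_eq_two_of_ne_one E v c hc w hw
    (ramificationIdx'_ne_one_of_v_sub_galAdicCompletionMap_lt_one E c v hc w hw hα hα1 hint hlt)

/-- **type C: `v_w(ι_w a) = v_v(a)²`** (★ `valued_toPlace` with `e = 2`) — the `m_M = 2m`, `|ι ϖ| = exp(−2)` dictionary of the ramified branch. [cite: NeukirchANT1999, Ch. II §4 Prop. (4.3)] -/
theorem valued_toPlace_eq_sq_of_v_sub_galAdicCompletionMap_lt_one (hc : c ≠ 1) (w : PlacesOver E v) (hw : c • w.1 = w.1)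
    {α : w.1.adicCompletion E} (hα : galAdicCompletionMap (L := E) c hw α ≠ α) (hα1 : Valued.v α ≤ 1)
    (hint : ∀ z : w.1.adicCompletion E, Valued.v z ≤ 1 →
      Valued.v ((z - galAdicCompletionMap (L := E) c hw z) / (α - galAdicCompletionMap (L := E) c hw α)) ≤ 1)
    (hlt : Valued.v (α - galAdicCompletionMap (L := E) c hw α) < 1) (a : v.adicCompletion F) :
    Valued.v (toPlace v w a) = Valued.v a ^ 2 := by
  rw [valued_toPlace, ramificationIdx'_eq_two_of_v_sub_galAdicCompletionMap_lt_one E c v hc w hw hα hα1 hint hlt]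

/-- **type C: `|𝓀(E_w)| = |𝓀(F_v)|`** in the `Valued.ResidueField` currency (★ `natCard_residueField_eq_of_ramified`, ★ `natCard_residueField_eq_of_compatible` twice,
★ `natCard_residueField_valuativeRel_eq`). [cite: NeukirchANT1999, Ch. II §4 Prop. (4.3)] -/
theorem natCard_residueField_eq_of_v_sub_galAdicCompletionMap_lt_one (hc : c ≠ 1) (w : PlacesOver E v) (hw : c • w.1 = w.1)
    {α : w.1.adicCompletion E} (hα : galAdicCompletionMap (L := E) c hw α ≠ α) (hα1 : Valued.v α ≤ 1)
    (hint : ∀ z : w.1.adicCompletion E, Valued.v z ≤ 1 →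
      Valued.v ((z - galAdicCompletionMap (L := E) c hw z) / (α - galAdicCompletionMap (L := E) c hw α)) ≤ 1)
    (hlt : Valued.v (α - galAdicCompletionMap (L := E) c hw α) < 1) :
    Nat.card (Valued.ResidueField (w.1.adicCompletion E)) = Nat.card (Valued.ResidueField (v.adicCompletion F)) := by
  rw [← natCard_residueField_eq_of_compatible (K := w.1.adicCompletion E),
    natCard_residueField_eq_of_ramified c v hc w hw (ramificationIdx'_ne_one_of_v_sub_galAdicCompletionMap_lt_one E c v hc w hw hα hα1 hint hlt),
    ← natCard_residueField_eq_of_compatible (K := v.adicCompletion F), natCard_residueField_valuativeRel_eq v]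

/-- The `Fintype.card` form of the previous statement. [cite: NeukirchANT1999, Ch. II §4 Prop. (4.3)] -/
theorem fintypeCard_residueField_eq_of_v_sub_galAdicCompletionMap_lt_one (hc : c ≠ 1) (w : PlacesOver E v) (hw : c • w.1 = w.1)
    {α : w.1.adicCompletion E} (hα : galAdicCompletionMap (L := E) c hw α ≠ α) (hα1 : Valued.v α ≤ 1)
    (hint : ∀ z : w.1.adicCompletion E, Valued.v z ≤ 1 →
      Valued.v ((z - galAdicCompletionMap (L := E) c hw z) / (α - galAdicCompletionMap (L := E) c hw α)) ≤ 1)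
    (hlt : Valued.v (α - galAdicCompletionMap (L := E) c hw α) < 1)
    [Fintype (Valued.ResidueField (w.1.adicCompletion E))] [Fintype (Valued.ResidueField (v.adicCompletion F))] :
    Fintype.card (Valued.ResidueField (w.1.adicCompletion E)) = Fintype.card (Valued.ResidueField (v.adicCompletion F)) := by
  rw [Fintype.card_eq_nat_card, Fintype.card_eq_nat_card]
  exact natCard_residueField_eq_of_v_sub_galAdicCompletionMap_lt_one E c v hc w hw hα hα1 hint hlt

end AlphaKeyed

end Summit.HodgeConjecture.HodgeConjecture.Cruxes.H413.F0P3cDyRamUnramifiedQuadraticCompletionDictionary
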